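import Summits.BirchSwinnertonDyer.BirchSwinnertonDyer.Theorems.SylvesterTwoHeegnerIndexCoupledTelescopeBasis
import Summits.BirchSwinnertonDyer.BirchSwinnertonDyer.Theorems.SylvesterTwoHeegnerIndexCoupledTelescopeStep
import HarnessLib

/-!
# The COUPLED Cassels–Tate telescope, X: the LIFT PACKAGE — hT^κ's lift family for ONE curve from
# admissible lifts of a `ℤ`-basis of the `ℚ`-Lagrangian (generic-witness form; pure algebra)

Crux `UpperOffV0HSYPlus` (stmt-BirchSwinnertonDyer-19804); census theorems p704180 / p704241
(`tailFour/tailSeven_of_coupledTelescope_of_leaves_kappa`, display hT^κ).  After p701264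
(`exists_coisotropic_lagrangian_of_package`: the Lagrangian `L ≤ Ш(X/ℚ)[2^∞]` with
`D_X = closure (r(L) ∪ w '' r(L))` isotropic and coisotropic for the given pairing) the rows still owe
hT^κ's LIFT conjuncts per curve: Selmer classes `s_i`, admissible, of exact orders `2^{N_i}` with room,
`𝒪`-independent (together with the bottom class `x` on `B`), whose `𝒪`-span maps onto `D_X` through
`torsionH1ToH1` ((gen)).  This file packages them from ONE arithmetic input per basis vector — an
ADMISSIBLE LIFT OF THE SAME `2`-POWER ORDER (`hlift`; rows: the tree's `Sel_n ↠ Ш[n]` over `ℚ`,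
p696786's exact-order correction, restriction to `K`) — and the Selmer-level `𝒪`-operator over the SAME
`w` (`hτw`; k-ty1), in GENERIC-WITNESS form (planner D586: maps and consumed properties as BINDERS;
abstract groups `M₀` (for `Ш(X/ℚ)[2^∞]`), `M` (for `Ш(X_K)[2^∞]`), `S` (for `H¹(K, X[n])`), `Q` (for
`H¹(K, X)`), `ι : M →+ Q` the inclusion, `τ : S →+ Q` for `torsionH1ToH1`):

* `exists_lift_family` — from `L` (finite, `2`-primary), `r, wM, ι` (injective), `Sel, Adm ∋ 0, wS, τ`,
  `hτw`, the descent `hdesc : r c + wM (r d) = 0 → c = d = 0` on `L`, an exponent bound `2^e L = 0`,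
  `x` with `τ x = τ (wS x) = 0`, and `hlift` ⊢ `m`, `s : ℕ → S`, `N : ℕ → ℕ` with: `s i ∈ Sel ∩ Adm`;
  `s i = 0`, `N i = 0` for `i ≥ m`; `2^{N i} s_i = 0`; exactness `2^{N i - 1} s_i ≠ 0` (`i < m`,
  `N i ≠ 0`); `N i ≤ e`; images `τ (s i) = ι a`, `τ (wS (s i)) = ι (wM a)` with `a ∈ D`; `𝒪`-independence
  WITH `x` over ANY finset of indices; (gen) every `d ∈ D` is `τ g` for some `g` in the `𝒪`-span of
  `s_0, …, s_{m-1}` modulo `ι`.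

Proof: `ℤ`-basis of `L` (`exists_basis_two_primary`, p701140), its descent (`descended_basis`: divisible
`𝒪`-independence of `r(g_i), wM r(g_i)` and the closure identity), `hlift` at each basis vector,
injectivity of `ι` for exactness/independence (`zsmul_add_zsmul_eq_zero_of_dvd`, p696786), and
`exists_sum_of_mem_closure` (p693296) for (gen).  Theorem-only (no definition, no named fact); nothing
asserted on 19804; no stub closed; BSD not claimed for any curve.  Sources: McCallum 1991 §5 (p. 288,
the lifts `c_i` of the generators `d_i` of `D`); MEMO-bsd-cm-two §59.2, §64.5 SET-UP.  The companion
`…CoupledTelescopeLiftInterleave` re-indexes an `A`-family and a `B`-family to hT^κ's odd/even conjuncts.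
-/

-- every Summits module is named `Summit.<Summit>.<Problem>…`: the duplicated component is by design
set_option linter.dupNamespace false
set_option autoImplicit false

open scoped Classical

namespace Summit.BirchSwinnertonDyer.BirchSwinnertonDyer.Theorems.SylvesterTwoCoupledTelescope

section LiftFamily

variable {M₀ M S Q : Type*} [AddCommGroup M₀] [AddCommGroup M] [AddCommGroup S] [AddCommGroup Q]

/-- **The lift family of ONE curve** (hT^κ's lift conjuncts for `X`, generic-witness form): from
admissible lifts of the same `2`-power order of a `ℤ`-basis of the `ℚ`-Lagrangian `L` (`hlift`), the
Selmer-level `𝒪`-operator over the same `w` (`hτw`) and the descent on `L` (`hdesc`) — a family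
`s : ℕ → S`, `N : ℕ → ℕ` (zero beyond `m`) in `Sel ∩ Adm` with `2^{N i} s_i = 0`, exact orders, room
`N i ≤ e`, images in `D = closure (r(L) ∪ wM '' r(L))` modulo `ι`, `𝒪`-independence together with the
bottom class `x` (`τ x = τ (wS x) = 0`) over any finset, and (gen) `D ⊆ τ(𝒪-span of the s_i)` modulo
`ι`.  McCallum p. 288: «let `d_i` be a generator of `D_i` and let `c_i` be a lifting of `d_i`».
[cite: McCallumLMS1991, §5 Thm. 5.4 (proof, p. 288)] -/
theorem exists_lift_family (L : AddSubgroup M₀) [Finite L]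
    (hprim : ∀ c : M₀, ∃ k : ℕ, ((2 : ℤ) ^ k) • c = 0)
    (r : M₀ →+ M) (wM : M →+ M) (ι : M →+ Q) (hι : Function.Injective ι)
    (Sel : AddSubgroup S) (Adm : Set S) (h0 : (0 : S) ∈ Adm) (wS : S →+ S) (τ : S →+ Q)
    (hτw : ∀ s ∈ Sel, ∀ a : M, τ s = ι a → τ (wS s) = ι (wM a))
    (hdesc : ∀ c ∈ L, ∀ d ∈ L, r c + wM (r d) = 0 → c = 0 ∧ d = 0)
    (e : ℕ) (he : ∀ c ∈ L, ((2 : ℤ) ^ e) • c = 0)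
    (x : S) (hτx : τ x = 0) (hτwx : τ (wS x) = 0)
    (hlift : ∀ c ∈ L, ∀ k : ℕ, ((2 : ℤ) ^ k) • c = 0 →
      ∃ s ∈ Sel, s ∈ Adm ∧ τ s = ι (r c) ∧ ((2 : ℤ) ^ k) • s = 0) :
    ∃ (m : ℕ) (s : ℕ → S) (N : ℕ → ℕ),
      (∀ i, s i ∈ Sel) ∧ (∀ i, s i ∈ Adm) ∧ (∀ i, m ≤ i → s i = 0 ∧ N i = 0) ∧
      (∀ i, ((2 : ℤ) ^ N i) • s i = 0) ∧
      (∀ i < m, N i ≠ 0 → ((2 : ℤ) ^ (N i - 1)) • s i ≠ 0) ∧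
      (∀ i, N i ≤ e) ∧
      (∀ i, ∃ a ∈ AddSubgroup.closure ((r '' (L : Set M₀)) ∪ wM '' (r '' (L : Set M₀))),
        τ (s i) = ι a ∧ τ (wS (s i)) = ι (wM a)) ∧
      (∀ (I : Finset ℕ) (b c : ℤ) (α β : ℕ → ℤ),
        (b • x + c • wS x) + ∑ i ∈ I, (α i • s i + β i • wS (s i)) = 0 →
          b • x + c • wS x = 0 ∧ ∀ i ∈ I, α i • s i + β i • wS (s i) = 0) ∧
      (∀ d ∈ AddSubgroup.closure ((r '' (L : Set M₀)) ∪ wM '' (r '' (L : Set M₀))),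
        ∃ g ∈ AddSubgroup.closure ((((Finset.range m).image s : Finset S) : Set S) ∪
          wS '' (((Finset.range m).image s : Finset S) : Set S)), τ g = ι d) := by
  -- ### a `ℤ`-basis `g_0, …, g_{m-1}` of `L` and its descent `r(g_i)`
  have hprimL : ∀ c : L, ∃ k : ℕ, ((2 : ℤ) ^ k) • c = 0 := fun c ↦ by
    obtain ⟨k, hk⟩ := hprim c
    exact ⟨k, Subtype.ext (by rw [AddSubgroupClass.coe_zsmul, hk, AddSubgroup.coe_zero])⟩
  obtain ⟨m, g, N, hN, hind, hgen⟩ := exists_basis_two_primary hprimL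
  have hdesc' : ∀ c d : L, (r.comp L.subtype) c + wM ((r.comp L.subtype) d) = 0 → c = 0 ∧ d = 0 := by
    intro c d h
    obtain ⟨hc, hd⟩ := hdesc c c.2 d d.2 h
    exact ⟨Subtype.ext hc, Subtype.ext hd⟩
  have hrinj : Function.Injective (r.comp L.subtype) := by
    intro c d h
    have h' : (r.comp L.subtype) (c - d) + wM ((r.comp L.subtype) 0) = 0 := by
      rw [map_sub, sub_eq_zero.mpr h, map_zero, map_zero, add_zero]
    exact sub_eq_zero.mp (hdesc' _ _ h').1
  obtain ⟨-, hindQ, hclos⟩ := descended_basis (r.comp L.subtype) wM hrinj hdesc' hN hind hgen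
  have hr' : ∀ i, (r.comp L.subtype) (g i) = r (g i) := fun _ ↦ rfl
  have hNc : ∀ i, ((2 : ℤ) ^ N i) • ((g i : L) : M₀) = 0 := fun i ↦ by
    rw [← AddSubgroupClass.coe_zsmul, hN i, AddSubgroup.coe_zero]
  -- the set `r(L)` is the range of `r ∘ (L ↪ M₀)`
  have hrange : r '' (L : Set M₀) = Set.range (r.comp L.subtype) := by
    ext y
    simp only [Set.mem_image, SetLike.mem_coe, Set.mem_range, AddMonoidHom.coe_comp,
      AddSubgroup.coe_subtype, Function.comp_apply, Subtype.exists, exists_prop]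
  -- ### the lifts of the basis vectors
  choose sf hsfSel hsfAdm hsfτ hsfk using hlift
  let s : ℕ → S := fun i ↦ if h : i < m then sf (g i) (g i).2 (N i) (hNc i) else 0
  let N' : ℕ → ℕ := fun i ↦ if i < m then N i else 0
  have hs_lt : ∀ i, i < m → s i = sf (g i) (g i).2 (N i) (hNc i) := fun i h ↦ dif_pos h
  have hs_ge : ∀ i, ¬ i < m → s i = 0 := fun i h ↦ dif_neg h
  have hN_lt : ∀ i, i < m → N' i = N i := fun i h ↦ if_pos h
  have hN_ge : ∀ i, ¬ i < m → N' i = 0 := fun i h ↦ if_neg h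
  have hτs : ∀ i, i < m → τ (s i) = ι (r (g i)) := fun i h ↦ by
    rw [hs_lt i h]; exact hsfτ _ _ _ _
  have hτws : ∀ i, i < m → τ (wS (s i)) = ι (wM (r (g i))) := fun i h ↦
    hτw _ (by rw [hs_lt i h]; exact hsfSel _ _ _ _) _ (hτs i h)
  have hNs : ∀ i, ((2 : ℤ) ^ N' i) • s i = 0 := fun i ↦ by
    by_cases h : i < m
    · rw [hN_lt i h, hs_lt i h]; exact hsfk _ _ _ _
    · rw [hs_ge i h, smul_zero]
  -- `2^{N i} ∣ 2^j` forces `N i ≤ j`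
  have hle_of_dvd : ∀ {a b : ℕ}, ((2 : ℤ) ^ a ∣ (2 : ℤ) ^ b) → a ≤ b := fun {a b} h ↦ by
    have h' : (2 ^ a : ℕ) ∣ 2 ^ b := by exact_mod_cast h
    exact (Nat.pow_dvd_pow_iff_le_right one_lt_two).mp h'
  -- a term vanishes as soon as its coefficients are divisible by the annihilator
  have hterm : ∀ i (a b : ℤ), ((2 : ℤ) ^ N' i) ∣ a → ((2 : ℤ) ^ N' i) ∣ b →
      a • s i + b • wS (s i) = 0 := fun i a b ha hb ↦
    zsmul_add_zsmul_eq_zero_of_dvd (p := 2) wS (hNs i) ha hb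
  refine ⟨m, s, N', fun i ↦ ?_, fun i ↦ ?_, fun i hi ↦ ⟨hs_ge i (not_lt.mpr hi), hN_ge i (not_lt.mpr hi)⟩,
    hNs, fun i hi hNi h0' ↦ ?_, fun i ↦ ?_, fun i ↦ ?_, fun I b c α β h ↦ ?_, fun d hd ↦ ?_⟩
  · -- Selmer membership
    by_cases h : i < m
    · rw [hs_lt i h]; exact hsfSel _ _ _ _
    · rw [hs_ge i h]; exact zero_mem _
  · -- admissibility
    by_cases h : i < m
    · rw [hs_lt i h]; exact hsfAdm _ _ _ _
    · rw [hs_ge i h]; exact h0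
  · -- exactness of the orders: push `2^{N i - 1} s_i = 0` to `M` and use the divisible independence
    rw [hN_lt i hi] at hNi h0'
    have h1 : ((2 : ℤ) ^ (N i - 1)) • r (g i) = 0 := by
      apply hι
      rw [map_zsmul, map_zero, ← hτs i hi, ← map_zsmul, h0', map_zero]
    have hrel : ∑ j ∈ Finset.range m, ((if j = i then (2 : ℤ) ^ (N i - 1) else 0) •
        (r.comp L.subtype) (g j) + (0 : ℤ) • wM ((r.comp L.subtype) (g j))) = 0 := by
      simp only [zero_smul, add_zero, ite_smul, Finset.sum_ite_eq', Finset.mem_range.mpr hi,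
        if_true, hr']
      exact h1
    have hdvd := (hindQ _ (fun _ ↦ 0) hrel i (Finset.mem_range.mpr hi)).1
    simp only [if_true] at hdvd
    have := hle_of_dvd hdvd
    omega
  · -- room `N i ≤ e`
    by_cases hi : i < m
    · rw [hN_lt i hi]
      have hrel : ∑ j ∈ Finset.range m, (if j = i then (2 : ℤ) ^ e else 0) • g j = 0 := by
        simp only [ite_smul, zero_smul, Finset.sum_ite_eq', Finset.mem_range.mpr hi, if_true]
        exact Subtype.ext (by rw [AddSubgroupClass.coe_zsmul, he _ (g i).2, AddSubgroup.coe_zero])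
      have hdvd := hind _ hrel i (Finset.mem_range.mpr hi)
      simp only [if_true] at hdvd
      exact hle_of_dvd hdvd
    · rw [hN_ge i hi]; exact Nat.zero_le _
  · -- images in `D`
    by_cases hi : i < m
    · exact ⟨r (g i), AddSubgroup.subset_closure (Set.mem_union_left _
        (Set.mem_image_of_mem r (g i).2)), hτs i hi, hτws i hi⟩
    · refine ⟨0, zero_mem _, ?_, ?_⟩
      · rw [hs_ge i hi, map_zero, map_zero]
      · rw [hs_ge i hi, map_zero, map_zero, map_zero, map_zero]
  · -- `𝒪`-independence with `x` over the finset `I`: apply `τ`, land in `M` by `ι`-injectivity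
    have hτF : ∀ i, τ (α i • s i + β i • wS (s i)) =
        ι (if i < m then α i • r (g i) + β i • wM (r (g i)) else 0) := fun i ↦ by
      by_cases hi : i < m
      · rw [if_pos hi, map_add, map_zsmul, map_zsmul, hτs i hi, hτws i hi, map_add, map_zsmul,
          map_zsmul]
      · rw [if_neg hi, hs_ge i hi, map_zero, smul_zero, smul_zero, add_zero, map_zero, map_zero]
    have hsum0 : ∑ i ∈ I, (if i < m then α i • r (g i) + β i • wM (r (g i)) else 0) = 0 := by
      apply hι
      have hτh := congrArg τ h
      rw [map_add, map_add, map_zsmul, map_zsmul, hτx, hτwx, smul_zero, smul_zero, add_zero,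
        zero_add, map_sum, map_zero] at hτh
      simp only [hτF] at hτh
      rwa [← map_sum, ← (map_zero ι)] at hτh
    -- rewrite the relation as one over `range m` with coefficients cut off outside `I`
    have hrel : ∑ j ∈ Finset.range m, ((if j ∈ I then α j else 0) • (r.comp L.subtype) (g j) +
        (if j ∈ I then β j else 0) • wM ((r.comp L.subtype) (g j))) = 0 := by
      have hL : ∑ j ∈ Finset.range m, ((if j ∈ I then α j else 0) • (r.comp L.subtype) (g j) +
          (if j ∈ I then β j else 0) • wM ((r.comp L.subtype) (g j))) =
          ∑ j ∈ (Finset.range m).filter (fun j ↦ j ∈ I), (α j • r (g j) + β j • wM (r (g j))) := by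
        rw [Finset.sum_filter]
        refine Finset.sum_congr rfl fun j _ ↦ ?_
        split_ifs <;> simp [hr']
      have hR : ∑ i ∈ I, (if i < m then α i • r (g i) + β i • wM (r (g i)) else 0) =
          ∑ j ∈ I.filter (fun j ↦ j < m), (α j • r (g j) + β j • wM (r (g j))) := by
        rw [Finset.sum_filter]
      have hIJ : (Finset.range m).filter (fun j ↦ j ∈ I) = I.filter (fun j ↦ j < m) := by
        ext j
        simp only [Finset.mem_filter, Finset.mem_range]
        exact and_comm
      rw [hL, hIJ, ← hR, hsum0]
    have hterms : ∀ i ∈ I, α i • s i + β i • wS (s i) = 0 := by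
      intro i hiI
      by_cases hi : i < m
      · have hdvd := hindQ _ _ hrel i (Finset.mem_range.mpr hi)
        simp only [hiI, if_true] at hdvd
        exact hterm i _ _ (by rw [hN_lt i hi]; exact hdvd.1) (by rw [hN_lt i hi]; exact hdvd.2)
      · rw [hs_ge i hi, map_zero, smul_zero, smul_zero, add_zero]
    refine ⟨?_, hterms⟩
    rw [Finset.sum_eq_zero hterms, add_zero] at h
    exact h
  · -- (gen): write `d` in the descended basis and lift the combination
    rw [hrange, hclos] at hd
    obtain ⟨α, β, rfl⟩ := exists_sum_of_mem_closure wM (fun i ↦ (r.comp L.subtype) (g i))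
      (Finset.range m) hd
    refine ⟨∑ j ∈ Finset.range m, (α j • s j + β j • wS (s j)), ?_, ?_⟩
    · have hmem : ∀ j ∈ Finset.range m,
          s j ∈ (((Finset.range m).image s : Finset S) : Set S) := fun j hj ↦
        Finset.mem_coe.mpr (Finset.mem_image_of_mem s hj)
      refine AddSubgroup.sum_mem _ fun j hj ↦ AddSubgroup.add_mem _
        (AddSubgroup.zsmul_mem _ (AddSubgroup.subset_closure (Set.mem_union_left _ (hmem j hj))) _)
        (AddSubgroup.zsmul_mem _ (AddSubgroup.subset_closure (Set.mem_union_right _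
          (Set.mem_image_of_mem wS (hmem j hj)))) _)
    · rw [map_sum, map_sum]
      refine Finset.sum_congr rfl fun j hj ↦ ?_
      have hjm : j < m := Finset.mem_range.mp hj
      rw [map_add, map_zsmul, map_zsmul, hτs j hjm, hτws j hjm, map_add, map_zsmul, map_zsmul, hr']

end LiftFamily

end Summit.BirchSwinnertonDyer.BirchSwinnertonDyer.Theorems.SylvesterTwoCoupledTelescope
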